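import Summits.QuantumFields.QCD.Theorems.QuarksAsStableActionStableActionBridgeTorusDenominator
import Summits.QuantumFields.QCD.Theorems.QuarksAsStableActionStableActionBridgeCyclicTraceAPFlavour

/-!
# The denominator of the thermal lattice-QCD torus functional as a cyclic kernel trace
(crux `QuarksAsStableAction.StableActionBridge`, item stmt-QuantumFields-9737, line `Sketch`;
registered stub `integral_fermiBoltzmannAP_wilsonMeasure_eq_cyclic_trace`, the time-ANTIPERIODIC
twin of `integral_fermiBoltzmann_wilsonMeasure_eq_cyclic_supertrace`)

The thermal lattice-QCD expectation on the four-torus `(ℤ/N)⁴` with time-ANTIPERIODIC Wilson quarks,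
`qcdTorusExpectAP β N mq` (Montvay–Münster (4.34): the antiperiodic Grassmann time computes the
honest thermal trace `Tr T^N`, not the `(−1)^F`-twisted one), is a ratio whose denominator is the
Wilson-measure average of the fermionic partition function in the background field,

  `∫ dμ_W(U) ∫dψ̄dψ e^{−ψ̄ D^{AP}(U) ψ}`,   `μ_W = Z_W⁻¹ e^{−β S_W(U)} ∏_e dU_e`,
  `Z_W = ∫ e^{−β S_W} ∏_e dU_e`,

with `D^{AP}(U) = diracMatrixAP U mq` the flavour-diagonal `r = 1` antiperiodic Wilson–Dirac matrix
of `N_f` quark flavours of bare masses `m_f > −1` (fundamental representation of `SU(3)`).  This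
file identifies it — the honest thermal partition function — with a transfer-matrix TRACE:

  `∫ dμ_W ∫dψ̄dψ e^{−ψ̄D^{AP}ψ}
      = ε · (∫∫ ∏_t K_β(Us t, (Us (t+1))^{gs t}) · Tr ∏_t T̂_F(Us t) Γ(G_{gs t}) dUs dgs) / Z_W`,

where `ε = (−1)^{n(n−1)/2 + n}` (`n` = number of quark variables) is the fixed orientation sign of
the tree's Berezin integral (`∫dψ̄dψ e^{−ψ̄Dψ} = ε det D`, Montvay–Münster (4.17)), `K_β` is the
temporal-gauge transfer kernel of the gauge field (`gaugeSliceKernel`), `T̂_F` is Smit's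
`N_f`-flavour fermionic transfer operator on the slice Fock space (`fermionSliceOp`, Smit (6.91))
and `Γ(G_g)` the Fock-space gauge rotation (`fockGaugeAct`).  The Haar integrals over the temporal
links `gs t` are the Gauss-law projections `P̂₀`, so this is the honest `Z_AP ∝ Tr (𝕋 P̂₀)^N` of
Lüscher and Osterwalder–Seiler at kernel level.

Assembly (pure theorem file, no definitions):
* `fermiIntegral_fermiBoltzmannAP`: `∫dψ̄dψ e^{−ψ̄D^{AP}(U)ψ} = ε det D^{AP}(U)` pointwise in `U`
  (the tree's Gaussian Berezin formula `berezin_grassmannExp_quadratic_holds` at `A = −D^{AP}`);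
* `TorusDenominator.integral_wilsonMeasure_eq_div`: `∫ F dμ_W = (∫ e^{−β S_W(U)} F(U) ∏ dU_e) / Z_W`;
* the `N_f`-flavour thermal capstone C `qcd_boltzmannAP_integral_eq_cyclic_trace_flavour`:
  `∫ e^{−β S_W(U)} det D^{AP}(U) ∏ dU_e` is the cyclic kernel trace integral.

References: I. Montvay and G. Münster, *Quantum Fields on a Lattice*
[MontvayMunster1994, §4.1.3 (4.34)]; M. Lüscher, Commun. Math. Phys. 54 (1977) 283
[Luscher1977, pp. 283–292]; K. Osterwalder, E. Seiler, Ann. Phys. 110 (1978) 440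
[OsterwalderSeiler1978, §2]; J. Smit, *Introduction to Quantum Fields on a Lattice*
[Smit2023, §6.5 (6.87)–(6.91)].
-/

noncomputable section

namespace Summit.QuantumFields.QCD.Cruxes.StableActionBridge.Sketch

open MeasureTheory Matrix Literature.MathematicalPhysics.QuantumFieldTheory
  Literature.MathematicalPhysics.QuantumLattice
open Literature.Probability.LatticeModels (TorusSite)

/-- **Fermionic partition function in a background field, time-antiperiodic quarks**:
`∫dψ̄dψ e^{−ψ̄D^{AP}(U)ψ} = (−1)^{n(n−1)/2 + n} det D^{AP}(U)`, `n = #`quark variables (the tree's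
Gaussian Berezin formula `berezin (exp (ψ̄Aψ)) = (−1)^{n(n−1)/2} det A` at `A = −D^{AP}`, and
`det(−D) = (−1)^n det D`; Montvay–Münster (4.17), with the antiperiodic matrix of (4.34)).
[cite: MontvayMunster1994, §4.1 (4.17) and §4.1.3 (4.34)] -/
theorem fermiIntegral_fermiBoltzmannAP {Nf S : ℕ} [NeZero S]
    (U : GaugeConfig 4 S (Matrix.specialUnitaryGroup (Fin 3) ℂ)) (mq : Fin Nf → ℝ) :
    fermiIntegral (fermiBoltzmannAP U mq) =
      (-1 : ℂ) ^ (Fintype.card (FermiIdx Nf S) * (Fintype.card (FermiIdx Nf S) - 1) / 2 +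
          Fintype.card (FermiIdx Nf S)) * (diracMatrixAP U mq).det := by
  -- adapted from `fermiIntegral_fermiBoltzmann` (Literature `QCDPhaseQuenchedReweighting`)
  simp only [fermiIntegral, fermiBoltzmannAP]
  rw [berezin_grassmannExp_quadratic_holds ℂ (ι := FermiIdx Nf S) (-diracMatrixAP U mq),
    Matrix.det_neg, pow_add, mul_assoc]

/-- **The denominator of `qcdTorusExpectAP` as a transfer trace (stub
`integral_fermiBoltzmannAP_wilsonMeasure_eq_cyclic_trace` of line `Sketch`).**  For `N_f` flavours
of `r = 1` time-ANTIPERIODIC Wilson quarks of bare masses `m_f > −1` (fundamental representation of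
`SU(3)`) on the four-torus `(ℤ/N)⁴` at inverse coupling `β`, the Wilson-measure average of the
Berezin integral `∫dψ̄dψ e^{−ψ̄ D^{AP}(U) ψ}` — the honest thermal partition function — equals the
Berezin orientation sign `ε = (−1)^{n(n−1)/2+n}` times the cyclic kernel trace
`∫∫ ∏_t K_β(Us t, (Us (t+1))^{gs t}) · Tr ∏_t T̂_F(Us t) Γ(G_{gs t}) dUs dgs` of `N` projected
transfer kernels over the `N_f`-flavour slice Fock space, divided by the pure-gauge partition
function `Z_W = ∫ e^{−β S_W} ∏ dU_e`: the honest `Z_AP ∝ Tr (𝕋 P̂₀)^N` for time-antiperiodic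
Wilson quarks. [cite: MontvayMunster1994, §4.1.3 (4.34)] [cite: Luscher1977, pp. 283–292]
[cite: OsterwalderSeiler1978, §2] [cite: Smit2023, §6.5 (6.87)–(6.91)] -/
theorem integral_fermiBoltzmannAP_wilsonMeasure_eq_cyclic_trace : ∀ (Nf N : ℕ) [NeZero N] (β : ℝ) (mq : Fin Nf → ℝ), (∀ f, -1 < mq f) → ∫ U : GaugeConfig 4 N (Matrix.specialUnitaryGroup (Fin 3) ℂ), fermiIntegral (fermiBoltzmannAP U mq) ∂(wilsonMeasure (d := 4) (L := N) (fundamentalRep (Fin 3)) β) = (-1 : ℂ) ^ (Fintype.card (FermiIdx Nf N) * (Fintype.card (FermiIdx Nf N) - 1) / 2 + Fintype.card (FermiIdx Nf N)) * (∫ p : (ZMod N → GaugeConfig 3 N (Matrix.specialUnitaryGroup (Fin 3) ℂ)) × (ZMod N → TorusSite 3 N → Matrix.specialUnitaryGroup (Fin 3) ℂ), ((∏ t : ZMod N, gaugeSliceKernel β (p.1 t) (gaugeTransform (p.2 t) (p.1 (t + 1))) : ℝ) : ℂ) * (((List.range N).map fun i : ℕ => fermionSliceOp (p.1 (i : ZMod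 N)) mq * fockGaugeAct (Nf := Nf) (p.2 (i : ZMod N))).prod).trace ∂((Measure.pi fun _ : ZMod N => Measure.pi fun _ : Edge 3 N => haarProbability (Matrix.specialUnitaryGroup (Fin 3) ℂ)).prod (Measure.pi fun _ : ZMod N => Measure.pi fun _ : TorusSite 3 N => haarProbability (Matrix.specialUnitaryGroup (Fin 3) ℂ)))) / ((∫ U : GaugeConfig 4 N (Matrix.specialUnitaryGroup (Fin 3) ℂ), Real.exp (-(β * wilsonAction (fundamentalRep (Fin 3)) U)) ∂(Measure.pi fun _ : Edge 4 N => haarProbability (Matrix.specialUnitaryGroup (Fin 3) ℂ)) : ℝ) : ℂ) := by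
  intro Nf N _ β mq hm
  simp only [fermiIntegral_fermiBoltzmannAP]
  rw [integral_const_mul, TorusDenominator.integral_wilsonMeasure_eq_div
      (continuous_fundamentalRep (Fin 3)) β (fun U => (diracMatrixAP U mq).det),
    qcd_boltzmannAP_integral_eq_cyclic_trace_flavour Nf N β mq hm, mul_div_assoc]

end Summit.QuantumFields.QCD.Cruxes.StableActionBridge.Sketch

end
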